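import Mathlib
import Literature.NumberTheory.DiophantineGeometry.StewartPadicOrderLemma8Proofs

/-!
# Rigidity of the `n`-dependence of floor-free `p`-adic bounds (solo-ABC-informed, s7)

Sharpest-statement artefact for `Summit.ABC` (family `abc`, soloist `solo-ABC-informed`, paper
§2.2(iv) and P15).  Context: the one-prime shadow of `abc` is a bound for the Wieferich exponent
`W(p) = ord_p(2^{p-1} - 1)`; the record (Stewart 2013, Theorem 2; tree fact `stewart2013_thm2`)
is obtained from K. Yu's theorem on `p`-adic logarithmic forms (tree fact `Stewart2013_lemma5_rat`)
by *inflation*: one writes `2 = (2/(p₂⋯p_k)) · p₂ ⋯ p_k` with `k ≍ log p / log log p` auxiliary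
small primes, and wins because in Yu's bound every variable carries its own factor
`≈ 7e · k · h(αᵢ) / log p < 1/e`.  How far can inflation go?  Exactly as far as the dependence on
the number `n` of logarithms allows.  This file proves the *rigidity* of that dependence: write a
hypothetical bound of Yu's floor-free shape with an abstract per-variable factor `φ(n)`,

  `ord_p(α₁^{b₁}⋯αₙ^{bₙ} − 1) < K · n^A · (log p)^A · p · ∏ᵢ (φ(n) · h(αᵢ) / log p) · log B`

(`αᵢ ∈ ℚ` multiplicatively independent `p`-adic units, `h` the logarithmic height, `B = max(2,|bᵢ|)`,
all primes `p ≥ P₀`, all `n`; Yu 2013 has `φ(n) ≈ 7e·n`).  Then necessarily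

  `φ(n) > c · n / log n` for every `c < 1/(1.001·e)` and all large `n`

(`soloInformed_inflation_rigidity`; `1.001` is the constant of the tree's Chebyshev lemma
`exists_log_nth_prime_le`, any `1 + ε` would do).  Proof: the trivial fact `ord_p(2^{p-1} − 1) ≥ 1`
(Fermat), fed through the hypothetical bound for the inflated family `(2/(p₂⋯p_n), p₂, …, p_n)`
(the tree's `auxFamily`, with its multiplicative independence, unit and height lemmas) at a prime
`p ∈ (e^n, 4e^n]` (Bertrand), gives `1 < 8K·2^A·n^{2A+2}·(1.001·e·c)^n → 0` if
`φ(n) ≤ c·n/log n`.  Consequences recorded in the paper: inflation of a floor-free bound can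
never produce more than a power saving `W(p) < p^{1−1/(ce)}` (reached iff `φ(n) ≍ n/log n`);
a per-variable gain `1/log p` can never come with a Matveev-type constant `c^n`; with Yu's
`(7e·n)^n` the ceiling of inflation is `W(p) < p·exp(−(1+o(1)) log p/(7e² log log p))`, which is
Stewart's theorem up to the constant.  Nothing here is a statement about `abc` itself; it is a
certified constraint on the shape of the tools (door (B‑iii) of the paper).

References: C. L. Stewart, *On divisors of Lucas and Lehmer numbers*, Acta Math. 211 (2013),
291–314, Theorem 2 and Lemma 5 (arXiv:1008.1274, pp. 4, 8–10); K. Yu, *p-adic logarithmic forms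
and a problem of Erdős*, Acta Math. 211 (2013), 315–382, Main theorem.
-/

open Height Real Finset Filter
open Literature.NumberTheory.DiophantineGeometry.Dioph

namespace Summit.ABC.ABC.Theorems

/-- Real-variable input: for `0 ≤ θ < 1`, `M · n^D · θ^n < 1` for all large `n`. [folklore] -/
theorem soloInformed_eventually_poly_mul_geom_lt_one {θ M : ℝ} (hθ0 : 0 ≤ θ) (hθ1 : θ < 1)
    (hM : 0 ≤ M) (D : ℕ) : ∀ᶠ n : ℕ in atTop, M * ((n : ℝ) ^ D * θ ^ n) < 1 := by
  have hlim := tendsto_pow_const_mul_const_pow_of_abs_lt_one D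
    (show |θ| < 1 by rw [abs_of_nonneg hθ0]; exact hθ1)
  have hε : (0 : ℝ) < 1 / (M + 1) := by positivity
  filter_upwards [hlim.eventually (eventually_lt_nhds hε)] with n hn
  have hX0 : 0 ≤ (n : ℝ) ^ D * θ ^ n := by positivity
  calc M * ((n : ℝ) ^ D * θ ^ n) ≤ (M + 1) * ((n : ℝ) ^ D * θ ^ n) :=
        mul_le_mul_of_nonneg_right (by linarith) hX0
    _ < (M + 1) * (1 / (M + 1)) := mul_lt_mul_of_pos_left hn (by linarith)
    _ = 1 := by field_simp

/-- **Rigidity of the `n`-dependence (paper §2.2(iv), P15).** Suppose a bound of Yu's floor-free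
shape held over `ℚ` with an abstract per-variable factor `φ(n) ≥ 0`: for every finite index type
`ι` with `n = |ι| ≥ 1`, every prime `p ≥ P₀`, all non-zero `p`-adic units `αᵢ ∈ ℚ` that are
multiplicatively independent, and all `b ∈ ℤ^ι ∖ {0}`,
`ord_p(∏ αᵢ^{bᵢ} − 1) < K · n^A · (log p)^A · p · ∏ᵢ (φ(n) h(αᵢ)/log p) · log max(2, |bᵢ|)`.
Then for every `c` with `1.001 · e · c < 1`, eventually `φ(n) > c · n / log n`.  (So the
`n`-dependence of a floor-free `p`-adic bound can never be better than `≍ (n/log n)^n`, and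
inflation can never beat a power saving; see the module docstring.)
Proof: Fermat's `p ∣ 2^{p−1} − 1` against the bound for the inflated family
`(2/(p₂⋯pₙ), p₂, …, pₙ)` at a Bertrand prime `p ∈ (eⁿ, 4eⁿ]`, with the tree's `auxFamily`
lemmas and Chebyshev bound `exists_log_nth_prime_le`. [new: solo-ABC-informed s7] -/
theorem soloInformed_inflation_rigidity (φ : ℕ → ℝ) (K : ℝ) (A P₀ : ℕ) (hK : 0 ≤ K)
    (hφ : ∀ n, 0 ≤ φ n)
    (hB : ∀ (ι : Type) [Fintype ι], 0 < Fintype.card ι →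
      ∀ p : ℕ, p.Prime → P₀ ≤ p →
      ∀ α : ι → ℚ, (∀ i, α i ≠ 0) → (∀ i, padicValRat p (α i) = 0) →
        (∀ c : ι → ℤ, ∏ i, α i ^ c i = 1 → c = 0) →
      ∀ b : ι → ℤ, b ≠ 0 →
        (padicValRat p (∏ i, α i ^ b i - 1) : ℝ) <
          K * (Fintype.card ι : ℝ) ^ A * Real.log p ^ A * p *
            (∏ i, φ (Fintype.card ι) * logHeight₁ (α i) / Real.log p) *
            Real.log ((max 2 (Finset.univ.sup fun i => (b i).natAbs) : ℕ) : ℝ))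
    {c : ℝ} (hc : 1.001 * Real.exp 1 * c < 1) :
    ∀ᶠ n : ℕ in atTop, c * n / Real.log n < φ n := by
  classical
  -- the case `c < 0` is trivial
  rcases lt_or_ge c 0 with hc0 | hc0
  · refine Filter.eventually_atTop.2 ⟨2, fun n hn => ?_⟩
    have hn' : (0 : ℝ) < n := by exact_mod_cast (show 0 < n by omega)
    have hlog : 0 < Real.log n := Real.log_pos (by exact_mod_cast (show 1 < n by omega))
    have : c * n / Real.log n < 0 := div_neg_of_neg_of_pos (mul_neg_of_neg_of_pos hc0 hn') hlog
    linarith [hφ n]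
  -- `θ = 1.001 e c ∈ [0, 1)`
  set θ := 1.001 * Real.exp 1 * c with hθ
  have hθ0 : 0 ≤ θ := by positivity
  have hdecay := soloInformed_eventually_poly_mul_geom_lt_one hθ0 hc
    (show (0 : ℝ) ≤ 8 * K * 2 ^ A by positivity) (2 * A + 2)
  obtain ⟨k₁, hk₁3, hk₁⟩ := exists_log_nth_prime_le
  filter_upwards [hdecay, eventually_ge_atTop (max k₁ (max P₀ 3))] with k hk hkge
  by_contra hnot
  push Not at hnot
  -- sizes of `k`
  have hk₁k : k₁ ≤ k := le_trans (le_max_left _ _) hkge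
  have hP₀k : P₀ ≤ k := le_trans ((le_max_left _ _).trans (le_max_right _ _)) hkge
  have hk3 : 3 ≤ k := le_trans ((le_max_right _ _).trans (le_max_right _ _)) hkge
  have hk1 : 1 ≤ k := by omega
  have hk3r : (3 : ℝ) ≤ k := by exact_mod_cast hk3
  have hkpos : (0 : ℝ) < k := by linarith
  have hlogk1 : 1 ≤ Real.log k := by
    rw [Real.le_log_iff_exp_le hkpos]
    have := Real.exp_one_lt_d9; linarith
  have hlogkpos : 0 < Real.log k := by linarith
  -- Step 1: a prime `p` with `e^k < p ≤ 4 e^k`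
  set N := ⌈Real.exp k⌉₊ with hN
  have hexpk1 : 1 ≤ Real.exp k := by
    have := Real.add_one_le_exp (k : ℝ); linarith
  have hNexp : Real.exp k ≤ N := by rw [hN]; exact Nat.le_ceil _
  have hN0 : N ≠ 0 := by
    intro h
    have : (N : ℝ) = 0 := by exact_mod_cast h
    linarith
  obtain ⟨p, hp, hNp, hp2N⟩ := Nat.exists_prime_lt_and_le_two_mul N hN0
  have hp0 : (0 : ℝ) < p := by exact_mod_cast hp.pos
  have hexp_lt_p : Real.exp k < p := lt_of_le_of_lt hNexp (by exact_mod_cast hNp)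
  have hp_le : (p : ℝ) ≤ 4 * Real.exp k := by
    have h1 : (p : ℝ) ≤ 2 * N := by exact_mod_cast hp2N
    have h2 : (N : ℝ) < Real.exp k + 1 := by rw [hN]; exact Nat.ceil_lt_add_one (by positivity)
    linarith
  set L := Real.log p with hLdef
  have hkL : (k : ℝ) < L := by rw [hLdef, Real.lt_log_iff_exp_lt hp0]; exact hexp_lt_p
  have hLpos : 0 < L := by linarith
  have hL2k : L ≤ 2 * k := by
    have h1 : L ≤ Real.log (4 * Real.exp k) := Real.log_le_log hp0 hp_le
    rw [Real.log_mul (by norm_num) (Real.exp_pos _).ne', Real.log_exp] at h1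
    have h4 : Real.log 4 ≤ 3 := by
      have := Real.log_le_sub_one_of_pos (show (0 : ℝ) < 4 by norm_num); linarith
    linarith
  have hkp : k < p := by
    have h1 : (k : ℝ) + 1 ≤ Real.exp k := Real.add_one_le_exp _
    exact_mod_cast (show (k : ℝ) < p by linarith)
  have hP₀p : P₀ ≤ p := by omega
  have hp3 : 3 < p := by omega
  have hp2 : ¬ p ∣ 2 := by
    intro h; have := Nat.le_of_dvd two_pos h; omega
  have hp1 : ¬ p ∣ 1 := by
    intro h; have := Nat.le_of_dvd one_pos h; omega
  -- Step 2: the auxiliary primes `p₂, …, p_k ∉ {2, p}` among the first `k + 1` primes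
  set Bad : Finset ℕ := {2, p} with hBad
  have hBadcard : Bad.card ≤ 1 + 1 :=
    (Finset.card_insert_le _ _).trans (by rw [Finset.card_singleton])
  obtain ⟨P, hPcard, hPprop⟩ := exists_auxPrimes k 1 Bad hBadcard
  have hPprime : ∀ q ∈ P, q.Prime := fun q hq => (hPprop q hq).1
  have hPnot : ∀ q ∈ P, q ≠ 2 ∧ q ≠ p := by
    intro q hq
    have h := (hPprop q hq).2.1
    rw [hBad, Finset.mem_insert, Finset.mem_singleton] at h
    push Not at h
    exact h
  have hPab : ∀ q ∈ P, q.Prime ∧ ¬ q ∣ 2 * 1 := by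
    intro q hq
    refine ⟨hPprime q hq, fun h => (hPnot q hq).1 ?_⟩
    rw [mul_one] at h
    exact (Nat.prime_dvd_prime_iff_eq (hPprime q hq) Nat.prime_two).mp h
  have hPp : ∀ q ∈ P, q.Prime ∧ q ≠ p := fun q hq => ⟨hPprime q hq, (hPnot q hq).2⟩
  -- Step 3: the hypothetical bound for the inflated family with all exponents `p - 1`
  have hcard : Fintype.card (Option ↥P) = k := by
    rw [Fintype.card_option, Fintype.card_coe, hPcard]; omega
  have hα0 : ∀ i : Option ↥P, auxFamily 2 1 P i ≠ 0 := fun i =>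
    auxFamily_ne_zero two_pos one_pos hPprime i
  have hαu : ∀ i : Option ↥P, padicValRat p (auxFamily 2 1 P i) = 0 := fun i =>
    padicValRat_auxFamily hp hp2 hp1 hPp i
  have hind : ∀ e : Option ↥P → ℤ, ∏ i, auxFamily 2 1 P i ^ e i = 1 → e = 0 := fun e he =>
    auxFamily_multIndep two_pos one_pos (by norm_num) hPab e he
  have hb0 : (fun _ : Option ↥P => ((p - 1 : ℕ) : ℤ)) ≠ 0 := by
    intro h
    have := congrFun h none
    simp only [Pi.zero_apply, Nat.cast_eq_zero] at this
    omega
  have hV := hB (Option ↥P) (by rw [hcard]; omega) p hp hP₀p (auxFamily 2 1 P) hα0 hαu hind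
    (fun _ => ((p - 1 : ℕ) : ℤ)) hb0
  -- the left-hand side is `ord_p(2^{p-1} - 1) ≥ 1`
  have hne : (Finset.univ : Finset (Option ↥P)).Nonempty := ⟨none, Finset.mem_univ _⟩
  have hsup : (max 2 (Finset.univ.sup fun _ : Option ↥P => ((p - 1 : ℕ) : ℤ).natAbs) : ℕ) =
      p - 1 := by
    rw [Finset.sup_const hne, Int.natAbs_natCast]
    omega
  rw [prod_auxFamily_zpow one_pos hPprime (p - 1), padicValRat_div_pow_sub_one hp one_pos hp1,
    hsup, hcard] at hV
  have hLHS : (1 : ℝ) ≤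
      (((padicValInt p (((2 : ℕ) : ℤ) ^ (p - 1) - ((1 : ℕ) : ℤ) ^ (p - 1)) : ℕ) : ℤ) : ℝ) := by
    haveI := Fact.mk hp
    have hz : ((2 : ℕ) : ℤ) ^ (p - 1) - ((1 : ℕ) : ℤ) ^ (p - 1) = (2 : ℤ) ^ (p - 1) - 1 := by
      push_cast; ring
    have hcop : IsCoprime (2 : ℤ) (p : ℤ) := by
      have h : Nat.Coprime 2 p := (Nat.coprime_primes Nat.prime_two hp).2 (by omega)
      exact_mod_cast Nat.isCoprime_iff_coprime.2 h
    have hdvd : (p : ℤ) ^ 1 ∣ (2 : ℤ) ^ (p - 1) - 1 := by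
      rw [pow_one]; exact Int.prime_dvd_pow_sub_one hp hcop
    have hnz : (2 : ℤ) ^ (p - 1) - 1 ≠ 0 := by
      have : (2 : ℤ) ^ 1 ≤ 2 ^ (p - 1) := pow_le_pow_right₀ (by norm_num) (by omega)
      intro h0; simp at this; linarith
    rcases (padicValInt_dvd_iff 1 _).1 hdvd with h | h
    · exact absurd h hnz
    · rw [hz]; exact_mod_cast h
  -- Step 4: the upper bound `8 K 2^A k^{2A+2} θ^k` for the right-hand side
  have hprodφ : ∏ i : Option ↥P, φ k * logHeight₁ (auxFamily 2 1 P i) / L =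
      (φ k / L) ^ k * (logHeight₁ (auxFamily 2 1 P none) * ∏ q ∈ P, Real.log (q : ℕ)) := by
    have h1 : ∀ i : Option ↥P, φ k * logHeight₁ (auxFamily 2 1 P i) / L =
        (φ k / L) * logHeight₁ (auxFamily 2 1 P i) := fun i => by ring
    simp_rw [h1]
    rw [Finset.prod_mul_distrib, Finset.prod_const, Finset.card_univ, hcard,
      prod_logHeight₁_auxFamily hPprime]
  rw [hprodφ] at hV
  set m := 1.001 * Real.log k with hm
  have hm2 : Real.log 2 ≤ m := by
    have : Real.log 2 < 0.6931471808 := Real.log_two_lt_d9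
    rw [hm]; linarith
  have hm0 : 0 ≤ m := le_trans (Real.log_nonneg one_le_two) hm2
  have hlogq : ∀ q ∈ P, Real.log q ≤ m := by
    intro q hq
    have hq0 : (0 : ℝ) < q := by exact_mod_cast (hPprime q hq).pos
    calc Real.log q ≤ Real.log (Nat.nth Nat.Prime (k + 1)) :=
          Real.log_le_log hq0 (by exact_mod_cast (hPprop q hq).2.2)
      _ ≤ 1.001 * Real.log k := hk₁ k 1 hk₁k hk1
  have hlogq0 : ∀ q ∈ P, 0 ≤ Real.log (q : ℝ) := fun q hq =>
    Real.log_nonneg (by exact_mod_cast (hPprime q hq).one_lt.le)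
  have hh₀ : 0 ≤ logHeight₁ (auxFamily 2 1 P none) := zero_le_logHeight₁ _
  have hh₀' : logHeight₁ (auxFamily 2 1 P none) ≤ k * m := by
    have h1 := logHeight₁_auxFamily_none_le two_pos one_pos hPprime (a := 2) (b := 1) (P := P)
    have h3 : ∑ q ∈ P, Real.log (q : ℝ) ≤ (k - 1) * m := by
      have := Finset.sum_le_card_nsmul P (fun q : ℕ => Real.log (q : ℝ)) _ hlogq
      rw [hPcard, nsmul_eq_mul, Nat.cast_sub hk1, Nat.cast_one] at this
      exact this
    have h4 : Real.log ((1 : ℕ) : ℝ) = 0 := by simp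
    have h5 : Real.log ((2 : ℕ) : ℝ) = Real.log 2 := by norm_num
    rw [h4, h5] at h1
    nlinarith
  have hPr0 : 0 ≤ ∏ q ∈ P, Real.log (q : ℝ) := Finset.prod_nonneg hlogq0
  have hPr' : ∏ q ∈ P, Real.log (q : ℝ) ≤ m ^ (k - 1) := by
    calc ∏ q ∈ P, Real.log (q : ℝ) ≤ ∏ _q ∈ P, m := Finset.prod_le_prod hlogq0 hlogq
      _ = m ^ (k - 1) := by rw [Finset.prod_const, hPcard]
  have hH : logHeight₁ (auxFamily 2 1 P none) * ∏ q ∈ P, Real.log (q : ℕ) ≤ k * m ^ k := by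
    calc logHeight₁ (auxFamily 2 1 P none) * ∏ q ∈ P, Real.log (q : ℕ)
        ≤ (k * m) * m ^ (k - 1) := mul_le_mul hh₀' hPr' hPr0 (by positivity)
      _ = k * (m ^ (k - 1) * m) := by ring
      _ = k * m ^ k := by rw [pow_sub_one_mul (by omega) m]
  have hbase : φ k / L ≤ c / Real.log k := by
    calc φ k / L ≤ φ k / k := div_le_div_of_nonneg_left (hφ k) hkpos hkL.le
      _ ≤ (c * k / Real.log k) / k := div_le_div_of_nonneg_right hnot hkpos.le
      _ = c / Real.log k := by field_simp
  have hbase0 : 0 ≤ φ k / L := div_nonneg (hφ k) hLpos.le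
  have hpowφ : (φ k / L) ^ k ≤ (c / Real.log k) ^ k := pow_le_pow_left₀ hbase0 hbase k
  have hcm : c / Real.log k * m = 1.001 * c := by
    rw [hm]; field_simp
  have hDE : (φ k / L) ^ k * (logHeight₁ (auxFamily 2 1 P none) * ∏ q ∈ P, Real.log (q : ℕ)) ≤
      k * (1.001 * c) ^ k := by
    calc (φ k / L) ^ k * (logHeight₁ (auxFamily 2 1 P none) * ∏ q ∈ P, Real.log (q : ℕ))
        ≤ (c / Real.log k) ^ k * (k * m ^ k) :=
          mul_le_mul hpowφ hH (mul_nonneg hh₀ hPr0) (by positivity)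
      _ = k * (c / Real.log k * m) ^ k := by rw [mul_pow]; ring
      _ = k * (1.001 * c) ^ k := by rw [hcm]
  have hLA : L ^ A ≤ (2 * k) ^ A := pow_le_pow_left₀ hLpos.le hL2k A
  have hpE : (p : ℝ) ≤ 4 * Real.exp 1 ^ k := by rw [Real.exp_one_pow]; exact hp_le
  have hlogB : Real.log ((p - 1 : ℕ) : ℝ) ≤ 2 * k := by
    have h0 : (0 : ℝ) < ((p - 1 : ℕ) : ℝ) := by exact_mod_cast (show 0 < p - 1 by omega)
    have h1 : Real.log ((p - 1 : ℕ) : ℝ) ≤ L :=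
      Real.log_le_log h0 (by exact_mod_cast Nat.sub_le p 1)
    linarith
  have hlogB0 : 0 ≤ Real.log ((p - 1 : ℕ) : ℝ) :=
    Real.log_nonneg (by exact_mod_cast (show 1 ≤ p - 1 by omega))
  have hDE0 : 0 ≤ (φ k / L) ^ k *
      (logHeight₁ (auxFamily 2 1 P none) * ∏ q ∈ P, Real.log (q : ℕ)) :=
    mul_nonneg (pow_nonneg hbase0 k) (mul_nonneg hh₀ hPr0)
  have hRHS : K * (k : ℝ) ^ A * L ^ A * p *
      ((φ k / L) ^ k * (logHeight₁ (auxFamily 2 1 P none) * ∏ q ∈ P, Real.log (q : ℕ))) *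
      Real.log ((p - 1 : ℕ) : ℝ) ≤
      K * (k : ℝ) ^ A * (2 * k) ^ A * (4 * Real.exp 1 ^ k) * (k * (1.001 * c) ^ k) * (2 * k) := by
    have h1 : K * (k : ℝ) ^ A * L ^ A ≤ K * (k : ℝ) ^ A * (2 * k) ^ A :=
      mul_le_mul_of_nonneg_left hLA (by positivity)
    have h2 : K * (k : ℝ) ^ A * L ^ A * p ≤ K * (k : ℝ) ^ A * (2 * k) ^ A * (4 * Real.exp 1 ^ k) :=
      mul_le_mul h1 hpE hp0.le (by positivity)
    have h3 := mul_le_mul h2 hDE hDE0 (by positivity)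
    exact mul_le_mul h3 hlogB hlogB0 (by positivity)
  have hU : K * (k : ℝ) ^ A * (2 * k) ^ A * (4 * Real.exp 1 ^ k) * (k * (1.001 * c) ^ k) * (2 * k) =
      8 * K * 2 ^ A * ((k : ℝ) ^ (2 * A + 2) * θ ^ k) := by
    rw [hθ]; ring
  -- Step 5: contradiction `1 ≤ ord_p(2^{p-1} - 1) < RHS ≤ U < 1`
  have hfin := lt_of_lt_of_le hV (hRHS.trans hU.le)
  linarith
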